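import Literature.Geometry.Kaehler.ComplexTorusAnalyticIntersectionNumber
import HarnessLib

/-!
# `[Y₁] · [Y₂] ≠ 0 ⟺ Y₁ − Y₂ = X`: surjectivity of the difference map and the intersection product on a
# complex torus (all expected dimensions)

Layer `Literature/Geometry/Kaehler`; lane `lit-hodgefound`, seat p07, programme «REMMERT'S OPEN MAPPING
THEOREM AND THE POSITIVITY OF INTERSECTION MULTIPLICITIES», file 7. For closed analytic subsets `Y₁, Y₂` of
pure dimensions `d₁, d₂` of a compact complex torus `X` with `d₁ + d₂ ≥ g`, the difference map
`δ : Y₁ × Y₂ → X`, `δ(y₁, y₂) = y₁ − y₂`, is onto if and only if `[Y₁] · [Y₂] ≠ 0`: indeed `t ∈ Y₁ − Y₂` iff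
`Y₁` meets the translate `t + Y₂`, and

> [Fulton1998, Example 11.4.5 / §12.2 Example 12.2.1 (a)] (a connected group acting transitively): "`φ_g(V)` meets
> `W` properly for generic `g`", "the cycles `φ_g(V) · W` represent the class `V · W`"; [Fulton1998, §11.1
> Cor. 11.1]: the intersection class is supported on `V ∩ W`. [Lange2023AbelianVarietiesComplex, §6.2.1 and
> Ex. 6.2.5 (1)]: translates are algebraically equivalent, `[t + Z] = [Z]`.

so `[Y₁] · [Y₂] = [Y₁] · [t + Y₂]` vanishes as soon as ONE translate misses `Y₁`, and is non-zero when every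
translate meets `Y₁` (the general one in a set of the expected pure dimension, Kleiman (a)). The case of
positive expected dimension `d₁ + d₂ − g ≥ 1` is `ComplexTorusAnalyticIntersectionCycle` §8; this file adds the
case `d₁ + d₂ = g` (through the generic point count of `ComplexTorusAnalyticIntersectionNumber` §3) and the
reading in terms of `Y₁ − Y₂`.

Contents (theorems only; no definitions, no named facts):

* §1 `sub_eq_univ_iff_forall_inter_vadd_nonempty` (`Y₁ − Y₂ = X ⟺` every translate `t + Y₂` meets `Y₁`),
  `isOpen_setOf_inter_translate_eq_empty` (the translates missing `Y₁` form an open set);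
* §2 expected dimension `≥ 1`: **`wedge_analyticCycleClass_ne_zero_iff_sub_eq_univ`**,
  **`sub_eq_univ_of_hasPureDim_inter_vadd`** (one translate meeting `Y₁` in a set of the expected pure dimension
  forces all translates to meet `Y₁`), `sub_eq_univ_of_codim_le_inter_vadd` (one proper POINT suffices);
* §3 expected dimension `0` (`d₁ + d₂ = g`): **`wedge_analyticCycleClass_ne_zero_iff_forall_inter_translate_nonempty_of_dim_zero`**,
  `wedge_analyticCycleClass_ne_zero_iff_sub_eq_univ_of_dim_zero`, **`sub_eq_univ_of_hasPureDim_zero_inter_vadd`**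
  (one translate meeting `Y₁` in a finite non-empty set forces `Y₁ − Y₂ = X`).

## References

* [Fulton1998] W. Fulton, *Intersection Theory*, 2nd ed., Springer 1998, §11.1 Cor. 11.1, Example 11.4.5,
  §12.2 Example 12.2.1 (a), §8.2 (8.8).
* [Kleiman1974Transversality] S. L. Kleiman, *The transversality of a general translate*, Compositio Math. 28
  (1974), Thm. 2.
* [Lange2023AbelianVarietiesComplex] H. Lange, *Abelian Varieties over the Complex Numbers*, Springer 2023,
  §6.2.1, Ex. 6.2.5 (1).
-/

noncomputable section

open scoped Manifold Topology Pointwise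
open MeasureTheory Set Function Filter Module
open Literature.LinearAlgebra.Alternating

namespace Literature.Geometry.Kaehler
namespace ComplexTorus

universe u

variable {ι : Type*} [Fintype ι] [DecidableEq ι] {E : Type u} [NormedAddCommGroup E] [InnerProductSpace ℂ E]
  [FiniteDimensional ℂ E] [MeasurableSpace E] [BorelSpace E] (Φ : (ι → ℝ) ≃L[ℝ] E) {n : ℕ} (e : Fin n ≃ ι)
  {d₁ d₂ p₁ p₂ q : ℕ}

/-! ### §1 `Y₁ − Y₂` and the translates of `Y₂` -/

omit [Fintype ι] [DecidableEq ι] [FiniteDimensional ℂ E] [MeasurableSpace E] [BorelSpace E] in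
/-- `(· + t)⁻¹' Y = (−t) +ᵥ Y`. [folklore] -/
private theorem preimage_add_right_eq_neg_vadd''' (Y : Set (ComplexTorus Φ)) (t : ComplexTorus Φ) :
    (fun x ↦ x + t) ⁻¹' Y = -t +ᵥ Y := by
  ext x
  rw [mem_preimage, Set.mem_vadd_set_iff_neg_vadd_mem, neg_neg, vadd_eq_add, add_comm]

omit [Fintype ι] [DecidableEq ι] [FiniteDimensional ℂ E] [MeasurableSpace E] [BorelSpace E] in
/-- `t ∈ Y₁ − Y₂ ⟺ Y₁ ∩ (t + Y₂) ≠ ∅`. [folklore] -/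
private theorem mem_sub_iff_inter_vadd_nonempty (Y₁ Y₂ : Set (ComplexTorus Φ)) (t : ComplexTorus Φ) :
    t ∈ Y₁ - Y₂ ↔ (Y₁ ∩ (t +ᵥ Y₂)).Nonempty := by
  rw [Set.mem_sub]
  constructor
  · rintro ⟨x, hx, y, hy, rfl⟩
    exact ⟨x, hx, Set.mem_vadd_set.2 ⟨y, hy, by rw [vadd_eq_add, sub_add_cancel]⟩⟩
  · rintro ⟨x, hx, hx'⟩
    obtain ⟨y, hy, rfl⟩ := Set.mem_vadd_set.1 hx'
    exact ⟨t +ᵥ y, hx, y, hy, by rw [vadd_eq_add, add_sub_cancel_right]⟩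

omit [Fintype ι] [DecidableEq ι] [FiniteDimensional ℂ E] [MeasurableSpace E] [BorelSpace E] in
/-- **`Y₁ − Y₂ = X` iff every translate `t + Y₂` meets `Y₁`** (the fibre of the difference map
`δ : Y₁ × Y₂ → X` over `t` is `{(t + y, y) | y ∈ Y₂, t + y ∈ Y₁} ≅ Y₁ ∩ (t + Y₂)`).
[cite: Fulton1998, Example 11.4.5] -/
theorem sub_eq_univ_iff_forall_inter_vadd_nonempty (Y₁ Y₂ : Set (ComplexTorus Φ)) :
    Y₁ - Y₂ = univ ↔ ∀ t : ComplexTorus Φ, (Y₁ ∩ (t +ᵥ Y₂)).Nonempty := by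
  simp only [eq_univ_iff_forall, mem_sub_iff_inter_vadd_nonempty]

omit [Fintype ι] [DecidableEq ι] [FiniteDimensional ℂ E] [MeasurableSpace E] [BorelSpace E] in
/-- **The translates of `Y₂` missing `Y₁` form an open set**: for closed `Y₁, Y₂ ⊆ X`,
`{t | Y₁ ∩ (Y₂ − t) = ∅}` is open (`X` is compact, so the projection `X × X → X` is closed and the set of `t`
with `Y₁ ∩ (Y₂ − t) ≠ ∅`, the projection of the closed set `{(x, t) | x ∈ Y₁, x + t ∈ Y₂}`, is closed).
[cite: Fulton1998, §11.1 Cor. 11.1] -/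
theorem isOpen_setOf_inter_translate_eq_empty {Y₁ Y₂ : Set (ComplexTorus Φ)} (hY₁ : IsClosed Y₁)
    (hY₂ : IsClosed Y₂) : IsOpen {t : ComplexTorus Φ | Y₁ ∩ (fun x ↦ x + t) ⁻¹' Y₂ = ∅} := by
  set C : Set (ComplexTorus Φ × ComplexTorus Φ) := {p | p.1 ∈ Y₁ ∧ p.1 + p.2 ∈ Y₂} with hCdef
  have hC : IsClosed C :=
    (hY₁.preimage continuous_fst).inter (hY₂.preimage (continuous_fst.add continuous_snd))
  have hC2 : IsClosed (Prod.snd '' C) := isClosedMap_snd_of_compactSpace _ hC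
  have hset : {t : ComplexTorus Φ | Y₁ ∩ (fun x ↦ x + t) ⁻¹' Y₂ = ∅} = (Prod.snd '' C)ᶜ := by
    ext t
    simp only [mem_setOf_eq, mem_compl_iff, mem_image, Prod.exists, exists_eq_right, hCdef,
      eq_empty_iff_forall_notMem, mem_inter_iff, mem_preimage, not_exists, not_and]
  rw [hset]
  exact hC2.isOpen_compl

/-! ### §2 Expected dimension `≥ 1` -/

/-- **`[Y₁] · [Y₂] ≠ 0 ⟺ Y₁ − Y₂ = X`** for `Y₁, Y₂` of pure dimensions `d₁, d₂` with expected intersection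
dimension `q + 1 = d₁ + d₂ − g ≥ 1` (`ComplexTorusAnalyticIntersectionCycle` §8 read through §1).
[cite: Fulton1998, §11.1 Cor. 11.1 and Example 11.4.5, §12.2 Example 12.2.1 (a)]
[cite: Kleiman1974Transversality, Thm. 2] [cite: Lange2023AbelianVarietiesComplex, §6.2.1 and Ex. 6.2.5 (1)] -/
theorem wedge_analyticCycleClass_ne_zero_iff_sub_eq_univ (hk₁ : 2 * d₁ + 2 * p₁ = n)
    (hk₂ : 2 * d₂ + 2 * p₂ = n) (hq : 2 * (q + 1) + 2 * (p₁ + p₂) = n) {Y₁ Y₂ : Set (ComplexTorus Φ)}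
    (hY₁ : HasPureDim 𝓘(ℂ, E) Y₁ d₁) (hY₂ : HasPureDim 𝓘(ℂ, E) Y₂ d₂) :
    (analyticCycleClass Φ e hk₁ hY₁).wedge (analyticCycleClass Φ e hk₂ hY₂) ≠ 0 ↔ Y₁ - Y₂ = univ := by
  rw [sub_eq_univ_iff_forall_inter_vadd_nonempty,
    wedge_analyticCycleClass_ne_zero_iff_forall_inter_vadd_nonempty Φ e hk₁ hk₂ hq hY₁ hY₂]

include e in
/-- **One translate meeting `Y₁` in a set of the expected pure dimension forces `Y₁ − Y₂ = X`** (expected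
dimension `q + 1 ≥ 1`): `[Y₁] · [t₀ + Y₂] ≠ 0` by the positivity of the intersection multiplicities
(`wedge_analyticCycleClass_ne_zero_of_hasPureDim_inter`), `= [Y₁] · [Y₂]` by translation invariance.
[cite: Fulton1998, §7.1 Prop. 7.1 (a), §12.2 Example 12.2.1 (a)] [cite: Lange2023AbelianVarietiesComplex, §6.2.1 and Ex. 6.2.5 (1)] -/
theorem sub_eq_univ_of_hasPureDim_inter_vadd (hk₁ : 2 * d₁ + 2 * p₁ = n) (hk₂ : 2 * d₂ + 2 * p₂ = n)
    (hq : 2 * (q + 1) + 2 * (p₁ + p₂) = n) {Y₁ Y₂ : Set (ComplexTorus Φ)}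
    (hY₁ : HasPureDim 𝓘(ℂ, E) Y₁ d₁) (hY₂ : HasPureDim 𝓘(ℂ, E) Y₂ d₂) {t₀ : ComplexTorus Φ}
    (hI : HasPureDim 𝓘(ℂ, E) (Y₁ ∩ (t₀ +ᵥ Y₂)) (q + 1)) : Y₁ - Y₂ = univ := by
  rw [← wedge_analyticCycleClass_ne_zero_iff_sub_eq_univ Φ e hk₁ hk₂ hq hY₁ hY₂,
    ← analyticCycleClass_vadd Φ e hk₂ hY₂ t₀]
  exact wedge_analyticCycleClass_ne_zero_of_hasPureDim_inter Φ e hk₁ hk₂ hq hY₁ (hasPureDim_vadd Φ hY₂ t₀) hI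

include e in
/-- **One PROPER POINT of one translate-intersection forces `Y₁ − Y₂ = X`**: if some `z ∈ Y₁ ∩ (t₀ + Y₂)` has a
neighbourhood in which `Y₁ ∩ (t₀ + Y₂)` has the expected dimension `q + 1 ≥ 1`, then every translate of `Y₂`
meets `Y₁` (`wedge_analyticCycleClass_ne_zero_of_codim_le`, Remmert + Kleiman + the moving lemma).
[cite: Fulton1998, §8.2 and §12.2 Example 12.2.1 (a)] [cite: Fischer1976, §3.9 Prop.] -/
theorem sub_eq_univ_of_codim_le_inter_vadd (hk₁ : 2 * d₁ + 2 * p₁ = n) (hk₂ : 2 * d₂ + 2 * p₂ = n)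
    (hq : 2 * (q + 1) + 2 * (p₁ + p₂) = n) {Y₁ Y₂ : Set (ComplexTorus Φ)}
    (hY₁ : HasPureDim 𝓘(ℂ, E) Y₁ d₁) (hY₂ : HasPureDim 𝓘(ℂ, E) Y₂ d₂) {t₀ z : ComplexTorus Φ}
    (hz : z ∈ Y₁ ∩ (t₀ +ᵥ Y₂))
    (hdim : ∀ᶠ x in 𝓝 z, x ∈ Y₁ ∩ (t₀ +ᵥ Y₂) → ∀ c, IsRegularPointOfCodim 𝓘(ℂ, E) (Y₁ ∩ (t₀ +ᵥ Y₂)) c x →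
      finrank ℂ E ≤ c + (q + 1)) : Y₁ - Y₂ = univ := by
  rw [← wedge_analyticCycleClass_ne_zero_iff_sub_eq_univ Φ e hk₁ hk₂ hq hY₁ hY₂,
    ← analyticCycleClass_vadd Φ e hk₂ hY₂ t₀]
  exact wedge_analyticCycleClass_ne_zero_of_codim_le Φ e hk₁ hk₂ hq hY₁ (hasPureDim_vadd Φ hY₂ t₀) hz hdim

/-! ### §3 Expected dimension `0` -/

/-- **`[Y₁] · [Y₂] ≠ 0 ⟺ Y₁ ∩ (Y₂ − t) ≠ ∅` for every `t`, complementary dimensions `d₁ + d₂ = g ≥ 1`.** (⟹) if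
one translate misses `Y₁`, so do all nearby translates (`isOpen_setOf_inter_translate_eq_empty`), a set of positive
Haar measure, while `[Y₁] · [Y₂] = #(Y₁ ∩ (Y₂ − t)) · vol` for almost every `t`
(`ae_finite_inter_translate_and_wedge_eq_ncard_smul_volumeForm`) would then vanish; (⟸) almost every
translate-intersection is empty or finite (Kleiman (a)), non-empty by hypothesis, so the generic point count is
`≥ 1`. [cite: Fulton1998, §8.2 (8.8), §11.1 Cor. 11.1 and Example 11.4.5] [cite: Kleiman1974Transversality, Thm. 2] -/
theorem wedge_analyticCycleClass_ne_zero_iff_forall_inter_translate_nonempty_of_dim_zero (hE : 0 < finrank ℂ E)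
    (hk₁ : 2 * d₁ + 2 * p₁ = n) (hk₂ : 2 * d₂ + 2 * p₂ = n) (h0 : 2 * 0 + 2 * (p₁ + p₂) = n)
    {Y₁ Y₂ : Set (ComplexTorus Φ)} (hY₁ : HasPureDim 𝓘(ℂ, E) Y₁ d₁) (hY₂ : HasPureDim 𝓘(ℂ, E) Y₂ d₂) :
    (analyticCycleClass Φ e hk₁ hY₁).wedge (analyticCycleClass Φ e hk₂ hY₂) ≠ 0 ↔
      ∀ t : ComplexTorus Φ, (Y₁ ∩ (fun x ↦ x + t) ⁻¹' Y₂).Nonempty := by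
  classical
  have hng : finrank ℂ E * 2 = n := finrank_complex_mul_two Φ e
  have hdim : d₁ + d₂ = 0 + finrank ℂ E := by omega
  have hae := ae_finite_inter_translate_and_wedge_eq_ncard_smul_volumeForm Φ e hE hk₁ hk₂ h0 hY₁ hY₂
  have hvol : volumeForm Φ ((finCongr (by omega : 2 * (p₁ + p₂) = n)).trans e) ≠ 0 := fun hv => by
    have h1 := torusIntegral_volumeForm Φ ((finCongr (by omega : 2 * (p₁ + p₂) = n)).trans e)
    rw [hv, torusIntegral_zero] at h1
    exact zero_ne_one h1
  constructor
  · intro hne t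
    by_contra hempty
    rw [not_nonempty_iff_eq_empty] at hempty
    -- the translates missing `Y₁` form an open set containing `t`, of positive measure
    have hopen := isOpen_setOf_inter_translate_eq_empty Φ hY₁.isAnalyticSet.isClosed hY₂.isAnalyticSet.isClosed
    have hpos : (volume : Measure (ComplexTorus Φ)) {t : ComplexTorus Φ | Y₁ ∩ (fun x ↦ x + t) ⁻¹' Y₂ = ∅} ≠ 0 :=
      (hopen.measure_pos volume ⟨t, hempty⟩).ne'
    obtain ⟨s, hs, hs'⟩ : ∃ s ∈ {t : ComplexTorus Φ | Y₁ ∩ (fun x ↦ x + t) ⁻¹' Y₂ = ∅},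
        (Y₁ ∩ (fun x ↦ x + s) ⁻¹' Y₂).Finite ∧
          ((analyticCycleClass Φ e hk₁ hY₁).wedge (analyticCycleClass Φ e hk₂ hY₂)).domDomCongr
              (finCongr (by ring : 2 * p₁ + 2 * p₂ = 2 * (p₁ + p₂))) =
            ((Y₁ ∩ (fun x ↦ x + s) ⁻¹' Y₂).ncard : ℂ) •
              volumeForm Φ ((finCongr (by omega : 2 * (p₁ + p₂) = n)).trans e) := by
      by_contra hcon
      exact hpos (measure_mono_null (fun s hs hP => hcon ⟨s, hs, hP⟩) (ae_iff.1 hae))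
    have hs0 : Y₁ ∩ (fun x ↦ x + s) ⁻¹' Y₂ = ∅ := hs
    rw [hs0, Set.ncard_empty, Nat.cast_zero, zero_smul ℂ (volumeForm Φ _)] at hs'
    exact hne ((domDomCongr_finCongr_eq_zero_iff _).1 hs'.2)
  · intro hall
    -- a generic translate-intersection is finite and non-empty, so the generic count is `≥ 1`
    have hgen := ae_inter_translate_eq_empty_or_hasPureDim Φ hdim hY₁ hY₂
    obtain ⟨t, ht, ht'⟩ := (hgen.and hae).exists
    have hfin : HasPureDim 𝓘(ℂ, E) (Y₁ ∩ (fun x ↦ x + t) ⁻¹' Y₂) 0 :=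
      ht.resolve_left (hall t).ne_empty
    have hpos : 0 < (Y₁ ∩ (fun x ↦ x + t) ⁻¹' Y₂).ncard :=
      (Set.ncard_pos (finite_of_hasPureDim_zero Φ hfin)).2 (hall t)
    intro h0'
    have h := ht'.2
    rw [h0', domDomCongr_finCongr_zero] at h
    have h' := (smul_eq_zero.1 h.symm).resolve_right hvol
    exact hpos.ne' (by exact_mod_cast h')

/-- **`[Y₁] · [Y₂] ≠ 0 ⟺ Y₁ − Y₂ = X`, complementary dimensions `d₁ + d₂ = g ≥ 1`.**
[cite: Fulton1998, Example 11.4.5 and §12.2 Example 12.2.1 (a)] [cite: Kleiman1974Transversality, Thm. 2] -/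
theorem wedge_analyticCycleClass_ne_zero_iff_sub_eq_univ_of_dim_zero (hE : 0 < finrank ℂ E)
    (hk₁ : 2 * d₁ + 2 * p₁ = n) (hk₂ : 2 * d₂ + 2 * p₂ = n) (h0 : 2 * 0 + 2 * (p₁ + p₂) = n)
    {Y₁ Y₂ : Set (ComplexTorus Φ)} (hY₁ : HasPureDim 𝓘(ℂ, E) Y₁ d₁) (hY₂ : HasPureDim 𝓘(ℂ, E) Y₂ d₂) :
    (analyticCycleClass Φ e hk₁ hY₁).wedge (analyticCycleClass Φ e hk₂ hY₂) ≠ 0 ↔ Y₁ - Y₂ = univ := by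
  rw [sub_eq_univ_iff_forall_inter_vadd_nonempty,
    wedge_analyticCycleClass_ne_zero_iff_forall_inter_translate_nonempty_of_dim_zero Φ e hE hk₁ hk₂ h0 hY₁ hY₂]
  constructor
  · intro h t
    have h' := h (-t)
    rwa [preimage_add_right_eq_neg_vadd''', neg_neg] at h'
  · intro h t
    rw [preimage_add_right_eq_neg_vadd''']
    exact h (-t)

include e in
/-- **A finite non-empty intersection with ONE translate forces `Y₁ − Y₂ = X`** (complementary dimensions):
`[Y₁] · [t₀ + Y₂] ≠ 0` by the positivity of the intersection multiplicities of the finite proper intersection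
(`wedge_analyticCycleClass_ne_zero_of_hasPureDim_zero_inter`), `= [Y₁] · [Y₂]` by translation invariance.
[cite: Fulton1998, §7.1 Prop. 7.1 (a), §8.2 (8.8), §12.2 Example 12.2.1 (a)]
[cite: Lange2023AbelianVarietiesComplex, §6.2.1 and Ex. 6.2.5 (1)] -/
theorem sub_eq_univ_of_hasPureDim_zero_inter_vadd (hE : 0 < finrank ℂ E)
    (hk₁ : 2 * d₁ + 2 * p₁ = n) (hk₂ : 2 * d₂ + 2 * p₂ = n) (h0 : 2 * 0 + 2 * (p₁ + p₂) = n)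
    {Y₁ Y₂ : Set (ComplexTorus Φ)} (hY₁ : HasPureDim 𝓘(ℂ, E) Y₁ d₁) (hY₂ : HasPureDim 𝓘(ℂ, E) Y₂ d₂)
    {t₀ : ComplexTorus Φ} (hI : HasPureDim 𝓘(ℂ, E) (Y₁ ∩ (t₀ +ᵥ Y₂)) 0) : Y₁ - Y₂ = univ := by
  rw [← wedge_analyticCycleClass_ne_zero_iff_sub_eq_univ_of_dim_zero Φ e hE hk₁ hk₂ h0 hY₁ hY₂,
    ← analyticCycleClass_vadd Φ e hk₂ hY₂ t₀]
  exact wedge_analyticCycleClass_ne_zero_of_hasPureDim_zero_inter Φ e hE hk₁ hk₂ h0 hY₁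
    (hasPureDim_vadd Φ hY₂ t₀) hI

end ComplexTorus
end Literature.Geometry.Kaehler

end
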